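import Summits.HodgeConjecture.HodgeConjecture.Theorems.VHCAbelianSchemesRoadMoverTrapDefs
import Literature.AlgebraicGeometry.KTheory.EulerCharacteristic
import HarnessLib

/-!
# Road №4 (`VHCAbelianSchemesRoad`), crux stmt-HodgeConjecture-26512 `DiagLocalOfMarkmanPinnedForall` — the OBJECTS of lens line N′
# «nowhere-displaceable» (`Cruxes/DiagLocalOfMarkmanPinnedForall/Lines/NowhereDisplaceable.lean` c9299650b742f1b3, §0), re-homed to the
# Theorems lane (director-hodge g17 R17.25 (3), idea-crit-6 g4 N2-7, LEAD 165 l.5902: Theorems files import NO Cruxes module — the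
# `…MoverTrapDefs` precedent for `extJumpLocus`)

research route conditional on HC_CM; not a corollary; Q11.4-sentence-2 already refuted in dim ≥ 3.

DEFINITIONS + ONE DEFINITIONAL `iff` ONLY — bodies BYTE-FOR-BYTE those of the line workfile l.111 ∕ l.118 ∕ l.123 ∕ l.132 ∕ l.139 ∕ l.147, so that
the bricks (N-F) `extJumpLocus_lifts` and (N-I) `properJump_of_confinedLifts` are stated over THESE constants and the later bind of the line's
stubs is one token. NOTHING here says (N-F), (N-I), (N-U), (S4) `stub_properJumpCarrierExists_End`, the crux, №4, HC_AV, HC_CM or HC holds;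
HC_CM HELD, by name only; typed ≠ proved. No `sorry`, no stub, no named fact.

* `ProperJump A E•` — the Ext-jump locus of `E•` (`MoverTrap.extJumpLocus`, p664145) off the identity lies in the `ℂ`-points of a PROPER
  closed subscheme of `A`; `DenseJump A E•` — its negation shape (every closed subscheme whose `ℂ`-points together with `1` contain the jump
  locus has all `ℂ`-points); `denseJump_iff_not_properJump`.
* `quotientPullbackComplex D E•` — `q^*E•`, the termwise pull-back along the quotient isogeny `q : J × Ĵ → Y = (J × Ĵ)∕Ḡ` of a
  secant–quotient datum (Mathlib's `Scheme.Modules.pullback` on cochain complexes).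
* `eulerPairingTranslate A E• x` — `χ(τ_x^*E•, E•) = Σ_k (−1)^k dim_ℂ Hom_{D(A)}(τ_x^*E•, E•⟦k⟧)` (junk values off bounded complexes of
  vector bundles), and `EulerPairingTranslationInvariant A E•` — its independence of `x` (the line's displayed input (N-E), a `Prop`).

References: [cite: Mukai1978, §3] [cite: MumfordAV1970, §5 Cor. 2 (p. 50) and §7 Thm. 4 (p. 72)] [cite: Hartshorne1977, III.6]
[cite: Markman2025SecantWeil, §9.3 Lemma 9.3.11].
-/

noncomputable section

open CategoryTheory CategoryTheory.Limits AlgebraicGeometry Topology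

namespace Summit.HodgeConjecture.HodgeConjecture.Ring2.SemiregularRepresentatives

set_option linter.dupNamespace false -- the cell's namespace repeats the summit name, as in every `Ring2*` file

namespace NowhereDisplaceable

open Literature.AlgebraicGeometry Literature.AlgebraicGeometry.Motives Literature.AlgebraicGeometry.Motives.AbelianVariety
open Summit.HodgeConjecture.HodgeConjecture.Ring2.SemiregularRepresentatives.MoverTrap

/-! ## §0 Objects -/

/-- **`ProperJump A E•` — (S4)'s matrix**: the Ext-jump locus of `E•` off the identity lies in the `ℂ`-points of a PROPER closed subscheme of `A`.
[cite: Mukai1978, §3] -/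
def ProperJump (A : AbelianVariety ℂ) (E : CochainComplex A.X.left.Modules ℤ) : Prop :=
  ∃ (V : SchemeOver ℂ) (ι : V ⟶ A.X), IsClosedImmersion ι.left ∧
    Set.range (AlgPoints.map (L := ℂ) ι) ≠ Set.univ ∧
    extJumpLocus A E ⊆ {1} ∪ Set.range (AlgPoints.map (L := ℂ) ι)

/-- **`DenseJump A E•` — NOWHERE-DISPLACEABILITY, the typed obstruction shape of the lens «negation»**: every closed subscheme whose `ℂ`-points
(together with `1`) contain the Ext-jump locus of `E•` has ALL `ℂ`-points — the jump locus is Zariski-dense off the identity. [cite: Mukai1978, §3] -/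
def DenseJump (A : AbelianVariety ℂ) (E : CochainComplex A.X.left.Modules ℤ) : Prop :=
  ∀ (V : SchemeOver ℂ) (ι : V ⟶ A.X), IsClosedImmersion ι.left →
    extJumpLocus A E ⊆ {1} ∪ Set.range (AlgPoints.map (L := ℂ) ι) → Set.range (AlgPoints.map (L := ℂ) ι) = Set.univ

/-- `DenseJump` is exactly `¬ ProperJump`. [folklore] -/
theorem denseJump_iff_not_properJump (A : AbelianVariety ℂ) (E : CochainComplex A.X.left.Modules ℤ) :
    DenseJump A E ↔ ¬ ProperJump A E := by
  simp only [DenseJump, ProperJump, not_exists, not_and]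
  refine forall₂_congr fun V ι => forall_congr' fun _ => ⟨fun h hne hsub => hne (h hsub), fun h hsub => ?_⟩
  by_contra hne
  exact h hne hsub

/-- **`q^*E•`** — the termwise pull-back of a complex on `Y = (J × Ĵ)∕Ḡ` along the quotient isogeny `q : J × Ĵ → Y` (Mathlib's `Scheme.Modules.pullback`).
[cite: Mukai1978, §3] [cite: MumfordAV1970, §7 Thm. 4 (p. 72)] -/
abbrev quotientPullbackComplex (D : SecantQuotientDatum) (E : CochainComplex D.Y.X.left.Modules ℤ) :
    CochainComplex D.P.X.left.Modules ℤ :=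
  ((Scheme.Modules.pullback (Hom.toSchemeHom D.q)).mapHomologicalComplex (ComplexShape.up ℤ)).obj E

/-- **The EULER SELF-PAIRING ALONG A TRANSLATE**, `χ(τ_x^*E•, E•) = Σ_k (−1)^k dim_ℂ Hom_{D(A)}(τ_x^*E•, E•⟦k⟧)` (finite sum of finite dimensions for a bounded
complex of vector bundles; `finsum` ∕ `finrank` carry the usual junk values elsewhere). Same ambient derived category and `ℂ`-linear structure as the route's
`extRank`. [cite: Mukai1978, §3] [cite: Hartshorne1977, III.6] -/
def eulerPairingTranslate (A : AbelianVariety ℂ) (E : CochainComplex A.X.left.Modules ℤ) (x : A.Points ℂ) : ℤ :=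
  letI := HasDerivedCategory.standard A.X.left.Modules
  ∑ᶠ k : ℤ, ((k.negOnePow : ℤˣ) : ℤ) *
    (Module.finrank ℂ (DerivedCategory.Q.obj (translationPullbackComplex A x E) ⟶
      (shiftFunctor (DerivedCategory A.X.left.Modules) k).obj (DerivedCategory.Q.obj E)) : ℤ)

/-- **TRANSLATION-INVARIANCE OF THE EULER PAIRING** (the displayed input (N-E)): `χ(τ_x^*E•, E•) = χ(E•, E•)` for all `x ∈ A(ℂ)`.
[cite: MumfordAV1970, §5 Cor. 2 (p. 50: Euler characteristic constant in flat families)] -/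
def EulerPairingTranslationInvariant (A : AbelianVariety ℂ) (E : CochainComplex A.X.left.Modules ℤ) : Prop :=
  ∀ x : A.Points ℂ, eulerPairingTranslate A E x = eulerPairingTranslate A E 1

end NowhereDisplaceable

end Summit.HodgeConjecture.HodgeConjecture.Ring2.SemiregularRepresentatives
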